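import Summits.CriticalPhenomena.PercolationContinuityZ3.Theorems.PercNearOneGluingNoHeavyLowerTailIncStarRootPairWalks
import Summits.CriticalPhenomena.PercolationContinuityZ3.Theorems.PercNearOneGluingNoHeavyLowerTailIncStarTargetTargetCells
import HarnessLib

/-!
# Root-pair chords at a separating vertex (B′-forest), II: the 2-separator dictionary

Support file for the Sahi programme (`--supports stmt-CriticalPhenomena-4575`, prover prim-sahi-p2 gen 19).  No definitions, no named
facts, no sorries; standard axioms.  Memo `prim-sahi-p2/PROOF-E3.md` (29n); blueprint `prim-sahi-p2/gen19/README.md`.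

Root `s`, a vertex `x ≠ s`, a side `L` (`s, x ∉ L`); `V₁ = insert x L`, `V₂ = {y | y ∉ L ∧ y ≠ s}` (so `V₁ ∪ V₂ = {y | y ≠ s}`, `V₁ ∩ V₂ = {x}`).
On configurations `ω` with the root pair `s(s, x)` closed and no open pair between `L` and `V₂ ∖ {x}`, the root connections factor through the
2-separator `{s, x}` (deterministic statements; `A_L t = {∃ u ∈ L, s(s,u) open ∧ u ↔ t in V₁}`, `F t = {x ↔ t in V₁}`, `B_R t`, `F_R t` likewise on `V₂`
with root pairs into `V₂ ∖ {x}`, `S_L = A_L x`, `S_R = B_R x`):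
* `rootPair_conn_left`:  `t ∈ V₁`: `s ↔ t ⟺ A_L t ∨ (S_R ∧ F t)`;   `rootPair_conn_right`: `t ∈ V₂`: `s ↔ t ⟺ B_R t ∨ (S_L ∧ F_R t)`;
* `rootPair_lift_left`:  `t ∈ V₁`: `s ↔ t` after opening `s(s,x)` `⟺ A_L t ∨ F t`;   `rootPair_lift_right`: `⟺ B_R t ∨ F_R t`.
Tools: `IncStar.openConn_iff_exists_firstStep`, `IncStar.openConn_avoid_or_through` (part I) and the cut-vertex lemmas
`IncStarCutVertex.openConnIn_union_iff_of_mem_left/right` applied in `V ∖ {s}` with cut vertex `x`.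
-/

noncomputable section

namespace Summit.CriticalPhenomena.PercolationContinuityZ3.Theorems

namespace IncStar

open MeasureTheory Set Literature.Probability.Percolation Literature.Probability.LatticeModels
open scoped Classical

variable {n : ℕ}

section Dictionary

variable (L : Set (Fin n)) {s x : Fin n} (hxs : x ≠ s) (hsL : s ∉ L) (hxL : x ∉ L) {ω : BondConfig (Fin n)}
  (hω : ∀ y z : Fin n, y ∈ L → z ∉ L → z ≠ s → z ≠ x → s(y, z) ∉ ω) (he : s(s, x) ∉ ω)

include hxs hsL hxL hω

omit hxL hω in
/-- `V ∖ {s}` is the union of the two sides. -/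
theorem rootPair_sides_union : (insert x L : Set (Fin n)) ∪ {y | y ∉ L ∧ y ≠ s} = {y | y ≠ s} := by
  ext y
  simp only [Set.mem_union, Set.mem_insert_iff, Set.mem_setOf_eq]
  constructor
  · rintro ((rfl | hy) | ⟨-, hy⟩)
    · exact hxs
    · exact fun h => hsL (h ▸ hy)
    · exact hy
  · intro hy
    by_cases hyL : y ∈ L
    · exact Or.inl (Or.inr hyL)
    · exact Or.inr ⟨hyL, hy⟩

omit hxs hsL hxL hω in
/-- The cut-vertex hypotheses of `IncStarCutVertex` for the two sides (and for the sides swapped). -/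
theorem rootPair_cut_hV : ∀ y : Fin n, y ∈ (insert x L : Set (Fin n)) → y ∈ {y : Fin n | y ∉ L ∧ y ≠ s} → y = x := by
  intro y hy1 hy2
  rcases (Set.mem_insert_iff.1 hy1) with h | h
  · exact h
  · exact absurd h hy2.1

omit hxs hsL hxL in
/-- No open pair from `L` to `V₂ ∖ {x}`. -/
theorem rootPair_cut_hω : ∀ y z : Fin n, y ∈ (insert x L : Set (Fin n)) → z ∈ {y : Fin n | y ∉ L ∧ y ≠ s} → y ≠ x → z ≠ x →
    s(y, z) ∉ ω := by
  intro y z hy hz hyx hzx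
  have hyL : y ∈ L := (Set.mem_insert_iff.1 hy).resolve_left hyx
  exact hω y z hyL hz.1 hz.2 hzx

omit hxs hsL hxL in
/-- No open pair from `V₂ ∖ {x}` to `L`. -/
theorem rootPair_cut_hω' : ∀ y z : Fin n, y ∈ {y : Fin n | y ∉ L ∧ y ≠ s} → z ∈ (insert x L : Set (Fin n)) → y ≠ x → z ≠ x →
    s(y, z) ∉ ω := by
  intro y z hy hz hyx hzx
  rw [Sym2.eq_swap]
  exact rootPair_cut_hω L hω z y hz hy hzx hyx

include he

/-- **Dictionary, near side**: for `t ∈ V₁ = insert x L`, `s ↔ t ⟺ A_L t ∨ (S_R ∧ F t)`. [this work] -/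
theorem rootPair_conn_left {t : Fin n} (ht : t ∈ (insert x L : Set (Fin n))) :
    ω ∈ openConn s t ↔
      (∃ u ∈ L, s(s, u) ∈ ω ∧ ω ∈ openConnIn (insert x L) u t) ∨
        ((∃ u ∈ {u : Fin n | u ∉ L ∧ u ≠ s ∧ u ≠ x}, s(s, u) ∈ ω ∧ ω ∈ openConnIn {y | y ∉ L ∧ y ≠ s} u x) ∧
          ω ∈ openConnIn (insert x L) x t) := by
  have hx1 : x ∈ (insert x L : Set (Fin n)) := Set.mem_insert x L
  have hx2 : x ∈ {y : Fin n | y ∉ L ∧ y ≠ s} := ⟨hxL, hxs⟩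
  have hts : t ≠ s := by
    rintro rfl
    rcases Set.mem_insert_iff.1 ht with h | h
    · exact hxs h.symm
    · exact hsL h
  have hV := rootPair_cut_hV L (s := s) (x := x)
  have hω₁ := rootPair_cut_hω L (s := s) (x := x) hω
  have hω₂ := rootPair_cut_hω' L (s := s) (x := x) hω
  have hU := rootPair_sides_union L hxs hsL
  constructor
  · intro h
    obtain ⟨u, hus, hsu, hc⟩ := (openConn_iff_exists_firstStep hts).1 h
    have hux : u ≠ x := fun h => he (h ▸ hsu)
    rw [← hU] at hc
    by_cases huL : u ∈ L
    · exact Or.inl ⟨u, huL, hsu,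
        (IncStarCutVertex.openConnIn_union_iff_of_mem_left hV hx1 hx2 hω₁ (Set.mem_insert_of_mem x huL) ht).1 hc⟩
    · have hu2 : u ∈ {y : Fin n | y ∉ L ∧ y ≠ s} := ⟨huL, hus⟩
      rw [Set.union_comm] at hc
      have h2 := (IncStarCutVertex.openConnIn_union_iff_of_mem_right (V₁ := {y : Fin n | y ∉ L ∧ y ≠ s})
        (V₂ := (insert x L : Set (Fin n))) (fun y hy2 hy1 => hV y hy1 hy2) hx2 hx1 hω₂ hu2 ht).1 hc
      exact Or.inr ⟨⟨u, ⟨huL, hus, hux⟩, hsu, h2.1⟩, h2.2⟩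
  · rintro (⟨u, huL, hsu, hc⟩ | ⟨⟨u, ⟨huL, hus, hux⟩, hsu, hc⟩, hF⟩)
    · have hsu' : s ≠ u := fun h => hsL (h ▸ huL)
      obtain ⟨r, -⟩ := BlockExploration.exists_openWalk_of_mem_openConnIn hc
      exact ⟨SimpleGraph.Walk.cons ((openGraph_adj ω s u).2 ⟨hsu, hsu'⟩) r⟩
    · obtain ⟨r₁, -⟩ := BlockExploration.exists_openWalk_of_mem_openConnIn hc
      obtain ⟨r₂, -⟩ := BlockExploration.exists_openWalk_of_mem_openConnIn hF
      exact ⟨SimpleGraph.Walk.cons ((openGraph_adj ω s u).2 ⟨hsu, hus.symm⟩) (r₁.append r₂)⟩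

/-- **Dictionary, far side**: for `t ∈ V₂` (`t ∉ L`, `t ≠ s`), `s ↔ t ⟺ B_R t ∨ (S_L ∧ F_R t)`. [this work] -/
theorem rootPair_conn_right {t : Fin n} (htL : t ∉ L) (hts : t ≠ s) :
    ω ∈ openConn s t ↔
      (∃ u ∈ {u : Fin n | u ∉ L ∧ u ≠ s ∧ u ≠ x}, s(s, u) ∈ ω ∧ ω ∈ openConnIn {y | y ∉ L ∧ y ≠ s} u t) ∨
        ((∃ u ∈ L, s(s, u) ∈ ω ∧ ω ∈ openConnIn (insert x L) u x) ∧ ω ∈ openConnIn {y | y ∉ L ∧ y ≠ s} x t) := by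
  have hx1 : x ∈ (insert x L : Set (Fin n)) := Set.mem_insert x L
  have hx2 : x ∈ {y : Fin n | y ∉ L ∧ y ≠ s} := ⟨hxL, hxs⟩
  have ht2 : t ∈ {y : Fin n | y ∉ L ∧ y ≠ s} := ⟨htL, hts⟩
  have hV := rootPair_cut_hV L (s := s) (x := x)
  have hω₁ := rootPair_cut_hω L (s := s) (x := x) hω
  have hω₂ := rootPair_cut_hω' L (s := s) (x := x) hω
  have hU := rootPair_sides_union L hxs hsL
  constructor
  · intro h
    obtain ⟨u, hus, hsu, hc⟩ := (openConn_iff_exists_firstStep hts).1 h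
    have hux : u ≠ x := fun h => he (h ▸ hsu)
    rw [← hU] at hc
    by_cases huL : u ∈ L
    · have h2 := (IncStarCutVertex.openConnIn_union_iff_of_mem_right hV hx1 hx2 hω₁ (Set.mem_insert_of_mem x huL) ht2).1 hc
      exact Or.inr ⟨⟨u, huL, hsu, h2.1⟩, h2.2⟩
    · have hu2 : u ∈ {y : Fin n | y ∉ L ∧ y ≠ s} := ⟨huL, hus⟩
      rw [Set.union_comm] at hc
      exact Or.inl ⟨u, ⟨huL, hus, hux⟩, hsu,
        (IncStarCutVertex.openConnIn_union_iff_of_mem_left (V₁ := {y : Fin n | y ∉ L ∧ y ≠ s})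
          (V₂ := (insert x L : Set (Fin n))) (fun y hy2 hy1 => hV y hy1 hy2) hx2 hx1 hω₂ hu2 ht2).1 hc⟩
  · rintro (⟨u, ⟨huL, hus, hux⟩, hsu, hc⟩ | ⟨⟨u, huL, hsu, hc⟩, hF⟩)
    · obtain ⟨r, -⟩ := BlockExploration.exists_openWalk_of_mem_openConnIn hc
      exact ⟨SimpleGraph.Walk.cons ((openGraph_adj ω s u).2 ⟨hsu, hus.symm⟩) r⟩
    · have hsu' : s ≠ u := fun h => hsL (h ▸ huL)
      obtain ⟨r₁, -⟩ := BlockExploration.exists_openWalk_of_mem_openConnIn hc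
      obtain ⟨r₂, -⟩ := BlockExploration.exists_openWalk_of_mem_openConnIn hF
      exact ⟨SimpleGraph.Walk.cons ((openGraph_adj ω s u).2 ⟨hsu, hsu'⟩) (r₁.append r₂)⟩

/-- **Lifted dictionary, near side**: for `t ∈ V₁`, after opening the root pair `s(s,x)`: `s ↔ t ⟺ A_L t ∨ F t`. [this work] -/
theorem rootPair_lift_left {t : Fin n} (ht : t ∈ (insert x L : Set (Fin n))) :
    insert s(s, x) ω ∈ openConn s t ↔
      (∃ u ∈ L, s(s, u) ∈ ω ∧ ω ∈ openConnIn (insert x L) u t) ∨ ω ∈ openConnIn (insert x L) x t := by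
  have hx1 : x ∈ (insert x L : Set (Fin n)) := Set.mem_insert x L
  have hx2 : x ∈ {y : Fin n | y ∉ L ∧ y ≠ s} := ⟨hxL, hxs⟩
  have hV := rootPair_cut_hV L (s := s) (x := x)
  have hω₁ := rootPair_cut_hω L (s := s) (x := x) hω
  have hU := rootPair_sides_union L hxs hsL
  have hdict := rootPair_conn_left L hxs hsL hxL hω he ht
  rw [insert_pair_mem_openConn_iff]
  constructor
  · have fromSt : ω ∈ openConn s t → (∃ u ∈ L, s(s, u) ∈ ω ∧ ω ∈ openConnIn (insert x L) u t) ∨ ω ∈ openConnIn (insert x L) x t :=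
      fun h => ((hdict.1 h).imp id fun h' => h'.2)
    rintro (h | ⟨-, h | h⟩)
    · exact fromSt h
    · exact fromSt h
    · rcases openConn_avoid_or_through s h with h' | h'
      · rw [← hU] at h'
        exact Or.inr ((IncStarCutVertex.openConnIn_union_iff_of_mem_left hV hx1 hx2 hω₁ hx1 ht).1 h')
      · exact fromSt h'
  · rintro (h | h)
    · exact Or.inl (hdict.2 (Or.inl h))
    · exact Or.inr ⟨Or.inl (SimpleGraph.Reachable.refl s), Or.inr (openConn_of_openConnIn h)⟩

/-- **Lifted dictionary, far side**: for `t ∈ V₂`, after opening `s(s,x)`: `s ↔ t ⟺ B_R t ∨ F_R t`. [this work] -/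
theorem rootPair_lift_right {t : Fin n} (htL : t ∉ L) (hts : t ≠ s) :
    insert s(s, x) ω ∈ openConn s t ↔
      (∃ u ∈ {u : Fin n | u ∉ L ∧ u ≠ s ∧ u ≠ x}, s(s, u) ∈ ω ∧ ω ∈ openConnIn {y | y ∉ L ∧ y ≠ s} u t) ∨
        ω ∈ openConnIn {y | y ∉ L ∧ y ≠ s} x t := by
  have hx1 : x ∈ (insert x L : Set (Fin n)) := Set.mem_insert x L
  have hx2 : x ∈ {y : Fin n | y ∉ L ∧ y ≠ s} := ⟨hxL, hxs⟩
  have ht2 : t ∈ {y : Fin n | y ∉ L ∧ y ≠ s} := ⟨htL, hts⟩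
  have hV := rootPair_cut_hV L (s := s) (x := x)
  have hω₂ := rootPair_cut_hω' L (s := s) (x := x) hω
  have hU := rootPair_sides_union L hxs hsL
  have hdict := rootPair_conn_right L hxs hsL hxL hω he htL hts
  rw [insert_pair_mem_openConn_iff]
  constructor
  · have fromSt : ω ∈ openConn s t →
        (∃ u ∈ {u : Fin n | u ∉ L ∧ u ≠ s ∧ u ≠ x}, s(s, u) ∈ ω ∧ ω ∈ openConnIn {y | y ∉ L ∧ y ≠ s} u t) ∨
          ω ∈ openConnIn {y | y ∉ L ∧ y ≠ s} x t :=
      fun h => ((hdict.1 h).imp id fun h' => h'.2)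
    rintro (h | ⟨-, h | h⟩)
    · exact fromSt h
    · exact fromSt h
    · rcases openConn_avoid_or_through s h with h' | h'
      · rw [← hU, Set.union_comm] at h'
        exact Or.inr ((IncStarCutVertex.openConnIn_union_iff_of_mem_left (V₁ := {y : Fin n | y ∉ L ∧ y ≠ s})
          (V₂ := (insert x L : Set (Fin n))) (fun y hy2 hy1 => hV y hy1 hy2) hx2 hx1 hω₂ hx2 ht2).1 h')
      · exact fromSt h'
  · rintro (h | h)
    · exact Or.inl (hdict.2 (Or.inl h))
    · exact Or.inr ⟨Or.inl (SimpleGraph.Reachable.refl s), Or.inr (openConn_of_openConnIn h)⟩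

end Dictionary


/-! ### Block bookkeeping (all configurations, all weights) -/

section Blocks

/-- A root-star connection to `t` plus `x ↔ t` inside the block gives the root-star connection to the port `x`. [this work] -/
theorem rootStar_port_of_rootStar_of_openConnIn (U V' : Set (Fin n)) {s x t : Fin n} (ω : BondConfig (Fin n))
    (h : ω ∈ {ω : BondConfig (Fin n) | ∃ u ∈ U, s(s, u) ∈ ω ∧ ω ∈ openConnIn V' u t}) (hF : ω ∈ openConnIn V' x t) :
    ω ∈ {ω : BondConfig (Fin n) | ∃ u ∈ U, s(s, u) ∈ ω ∧ ω ∈ openConnIn V' u x} := by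
  obtain ⟨u, hu, hsu, hc⟩ := h
  exact ⟨u, hu, hsu, Literature.Probability.Percolation.PlanarDuality.openConnIn_trans hc (openConnIn_symm' hF)⟩

/-- A root-star connection to the port `x` plus `x ↔ t` inside the block gives the root-star connection to `t`. [this work] -/
theorem rootStar_of_rootStar_port_of_openConnIn (U V' : Set (Fin n)) {s x t : Fin n} (ω : BondConfig (Fin n))
    (h : ω ∈ {ω : BondConfig (Fin n) | ∃ u ∈ U, s(s, u) ∈ ω ∧ ω ∈ openConnIn V' u x}) (hF : ω ∈ openConnIn V' x t) :
    ω ∈ {ω : BondConfig (Fin n) | ∃ u ∈ U, s(s, u) ∈ ω ∧ ω ∈ openConnIn V' u t} := by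
  obtain ⟨u, hu, hsu, hc⟩ := h
  exact ⟨u, hu, hsu, Literature.Probability.Percolation.PlanarDuality.openConnIn_trans hc hF⟩

/-- **`Z = m + D` in a block**: `P(T ∪ F) = P(T) + P(F ∖ S)` for the root-star event `T` of `t`, the block connection `F = {x ↔ t}` and the
root-star event `S` of the port. [this work] -/
theorem rootStar_union_split (μ : Measure (BondConfig (Fin n))) [IsProbabilityMeasure μ] (U V' : Set (Fin n)) (s x t : Fin n) :
    μ.real ({ω : BondConfig (Fin n) | ∃ u ∈ U, s(s, u) ∈ ω ∧ ω ∈ openConnIn V' u t} ∪ openConnIn V' x t)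
      = μ.real {ω : BondConfig (Fin n) | ∃ u ∈ U, s(s, u) ∈ ω ∧ ω ∈ openConnIn V' u t}
        + μ.real (openConnIn V' x t \ {ω : BondConfig (Fin n) | ∃ u ∈ U, s(s, u) ∈ ω ∧ ω ∈ openConnIn V' u x}) := by
  rw [← measureReal_union ?_ MeasurableSet.of_discrete]
  · congr 1
    ext ω
    simp only [Set.mem_union, Set.mem_sdiff]
    constructor
    · rintro (h | h)
      · exact Or.inl h
      · by_cases hS : ω ∈ {ω : BondConfig (Fin n) | ∃ u ∈ U, s(s, u) ∈ ω ∧ ω ∈ openConnIn V' u x}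
        · exact Or.inl (rootStar_of_rootStar_port_of_openConnIn U V' ω hS h)
        · exact Or.inr ⟨h, hS⟩
    · rintro (h | ⟨h, -⟩)
      · exact Or.inl h
      · exact Or.inr h
  · exact Set.disjoint_left.2 fun ω hT hF => hF.2 (rootStar_port_of_rootStar_of_openConnIn U V' ω hT hF.1)

/-- **`Z_bc = m_bc + Ξ_b + Ξ_c + D_bc` in a block** (two targets). [this work] -/
theorem rootStar_inter_union_split (μ : Measure (BondConfig (Fin n))) [IsProbabilityMeasure μ] (U V' : Set (Fin n)) (s x b c : Fin n) :
    μ.real (({ω : BondConfig (Fin n) | ∃ u ∈ U, s(s, u) ∈ ω ∧ ω ∈ openConnIn V' u b} ∪ openConnIn V' x b)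
        ∩ ({ω : BondConfig (Fin n) | ∃ u ∈ U, s(s, u) ∈ ω ∧ ω ∈ openConnIn V' u c} ∪ openConnIn V' x c))
      = μ.real ({ω : BondConfig (Fin n) | ∃ u ∈ U, s(s, u) ∈ ω ∧ ω ∈ openConnIn V' u b}
          ∩ {ω : BondConfig (Fin n) | ∃ u ∈ U, s(s, u) ∈ ω ∧ ω ∈ openConnIn V' u c})
        + μ.real ((openConnIn V' x b \ {ω : BondConfig (Fin n) | ∃ u ∈ U, s(s, u) ∈ ω ∧ ω ∈ openConnIn V' u x})
          ∩ {ω : BondConfig (Fin n) | ∃ u ∈ U, s(s, u) ∈ ω ∧ ω ∈ openConnIn V' u c})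
        + μ.real ((openConnIn V' x c \ {ω : BondConfig (Fin n) | ∃ u ∈ U, s(s, u) ∈ ω ∧ ω ∈ openConnIn V' u x})
          ∩ {ω : BondConfig (Fin n) | ∃ u ∈ U, s(s, u) ∈ ω ∧ ω ∈ openConnIn V' u b})
        + μ.real ((openConnIn V' x b ∩ openConnIn V' x c) \ {ω : BondConfig (Fin n) | ∃ u ∈ U, s(s, u) ∈ ω ∧ ω ∈ openConnIn V' u x}) := by
  set BRb : Set (BondConfig (Fin n)) := {ω : BondConfig (Fin n) | ∃ u ∈ U, s(s, u) ∈ ω ∧ ω ∈ openConnIn V' u b}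
  set BRc : Set (BondConfig (Fin n)) := {ω : BondConfig (Fin n) | ∃ u ∈ U, s(s, u) ∈ ω ∧ ω ∈ openConnIn V' u c}
  set SR : Set (BondConfig (Fin n)) := {ω : BondConfig (Fin n) | ∃ u ∈ U, s(s, u) ∈ ω ∧ ω ∈ openConnIn V' u x}
  set Fb : Set (BondConfig (Fin n)) := openConnIn V' x b
  set Fc : Set (BondConfig (Fin n)) := openConnIn V' x c
  have hm : ∀ X : Set (BondConfig (Fin n)), MeasurableSet X := fun _ => MeasurableSet.of_discrete
  have fR1 : ∀ {t : Fin n} (ω : BondConfig (Fin n)), ω ∈ {ω : BondConfig (Fin n) | ∃ u ∈ U, s(s, u) ∈ ω ∧ ω ∈ openConnIn V' u t} → ω ∈ openConnIn V' x t → ω ∈ SR :=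
    fun ω h hF => rootStar_port_of_rootStar_of_openConnIn U V' ω h hF
  have fR2 : ∀ {t : Fin n} (ω : BondConfig (Fin n)), ω ∈ SR → ω ∈ openConnIn V' x t → ω ∈ {ω : BondConfig (Fin n) | ∃ u ∈ U, s(s, u) ∈ ω ∧ ω ∈ openConnIn V' u t} :=
    fun ω h hF => rootStar_of_rootStar_port_of_openConnIn U V' ω h hF
  rw [← measureReal_union ?_ (hm _), ← measureReal_union ?_ (hm _), ← measureReal_union ?_ (hm _)]
  · congr 1
    ext ω
    simp only [Set.mem_union, Set.mem_inter_iff, Set.mem_sdiff]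
    constructor
    · rintro ⟨hB | hFb, hC | hFc⟩
      · exact Or.inl (Or.inl (Or.inl ⟨hB, hC⟩))
      · by_cases hC : ω ∈ BRc
        · exact Or.inl (Or.inl (Or.inl ⟨hB, hC⟩))
        · have hS : ω ∉ SR := fun hS => hC (fR2 ω hS hFc)
          exact Or.inl (Or.inr ⟨⟨hFc, hS⟩, hB⟩)
      · by_cases hB : ω ∈ BRb
        · exact Or.inl (Or.inl (Or.inl ⟨hB, hC⟩))
        · have hS : ω ∉ SR := fun hS => hB (fR2 ω hS hFb)
          exact Or.inl (Or.inl (Or.inr ⟨⟨hFb, hS⟩, hC⟩))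
      · by_cases hS : ω ∈ SR
        · exact Or.inl (Or.inl (Or.inl ⟨fR2 ω hS hFb, fR2 ω hS hFc⟩))
        · by_cases hB : ω ∈ BRb
          · by_cases hC : ω ∈ BRc
            · exact Or.inl (Or.inl (Or.inl ⟨hB, hC⟩))
            · exact Or.inl (Or.inr ⟨⟨hFc, hS⟩, hB⟩)
          · by_cases hC : ω ∈ BRc
            · exact Or.inl (Or.inl (Or.inr ⟨⟨hFb, hS⟩, hC⟩))
            · exact Or.inr ⟨⟨hFb, hFc⟩, hS⟩
    · rintro (((⟨hB, hC⟩ | ⟨⟨hFb, -⟩, hC⟩) | ⟨⟨hFc, -⟩, hB⟩) | ⟨⟨hFb, hFc⟩, -⟩)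
      · exact ⟨Or.inl hB, Or.inl hC⟩
      · exact ⟨Or.inr hFb, Or.inl hC⟩
      · exact ⟨Or.inl hB, Or.inr hFc⟩
      · exact ⟨Or.inr hFb, Or.inr hFc⟩
  · exact Set.disjoint_left.2 fun ω h1 h2 => by
      rcases h1 with (⟨hB, -⟩ | ⟨-, hC⟩) | ⟨-, hB⟩
      · exact h2.2 (fR1 ω hB h2.1.1)
      · exact h2.2 (fR1 ω hC h2.1.2)
      · exact h2.2 (fR1 ω hB h2.1.1)
  · exact Set.disjoint_left.2 fun ω h1 h2 => by
      rcases h1 with ⟨-, hC⟩ | ⟨-, hC⟩ <;> exact h2.1.2 (fR1 ω hC h2.1.1)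
  · exact Set.disjoint_left.2 fun ω h1 h2 => h2.1.2 (fR1 ω h1.1 h2.1.1)

end Blocks

/-! ### Independence of the two blocks -/

/-- **The near and far blocks are independent**: events determined by the pairs inside `insert x L` and the root pairs into `L`, resp. by the
pairs inside `{y | y ∉ L ∧ y ≠ s}` and the root pairs into `{u | u ∉ L ∧ u ≠ s ∧ u ≠ x}`, are independent under every `prodBernoulli w`
(disjoint coordinate sets; neither contains the root pair `s(s,x)`). [this work] -/
theorem rootPair_indep (w : Sym2 (Fin n) → unitInterval) (L : Set (Fin n)) {s x : Fin n} (hxs : x ≠ s) (hsL : s ∉ L)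
    {A B : Set (BondConfig (Fin n))}
    (hA : DeterminedBy A ({z : Sym2 (Fin n) | ¬ z.IsDiag ∧ ∀ v ∈ z, v ∈ (insert x L : Set (Fin n))} ∪ {z | ∃ u ∈ L, z = s(s, u)}))
    (hB : DeterminedBy B ({z : Sym2 (Fin n) | ¬ z.IsDiag ∧ ∀ v ∈ z, v ∈ {y : Fin n | y ∉ L ∧ y ≠ s}}
      ∪ {z | ∃ u ∈ {u : Fin n | u ∉ L ∧ u ≠ s ∧ u ≠ x}, z = s(s, u)})) :
    (prodBernoulli w).real (A ∩ B) = (prodBernoulli w).real A * (prodBernoulli w).real B := by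
  set V₁ : Set (Fin n) := insert x L
  set V₂ : Set (Fin n) := {y | y ∉ L ∧ y ≠ s}
  set R₀ : Set (Fin n) := {u : Fin n | u ∉ L ∧ u ≠ s ∧ u ≠ x}
  have hm : ∀ X : Set (BondConfig (Fin n)), MeasurableSet X := fun _ => MeasurableSet.of_discrete
  set KL : Set (Sym2 (Fin n)) := {z : Sym2 (Fin n) | ¬ z.IsDiag ∧ ∀ v ∈ z, v ∈ V₁} ∪ {z | ∃ u ∈ L, z = s(s, u)}
  set KR : Set (Sym2 (Fin n)) := {z : Sym2 (Fin n) | ¬ z.IsDiag ∧ ∀ v ∈ z, v ∈ V₂} ∪ {z | ∃ u ∈ R₀, z = s(s, u)}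
  have hKLR : KR ⊆ KLᶜ := by
    intro z hz hzL
    rcases hz with ⟨hzd, hz2⟩ | ⟨u, hu, rfl⟩
    · rcases hzL with ⟨-, hz1⟩ | ⟨u', hu', rfl⟩
      · revert hzd hz2 hz1
        refine Sym2.inductionOn z fun p q => ?_
        intro hzd hz2 hz1
        have hp : p = x := rootPair_cut_hV L p (hz1 p (Sym2.mem_mk_left p q)) (hz2 p (Sym2.mem_mk_left p q))
        have hq : q = x := rootPair_cut_hV L q (hz1 q (Sym2.mem_mk_right p q)) (hz2 q (Sym2.mem_mk_right p q))
        exact hzd (by rw [Sym2.mk_isDiag_iff, hp, hq])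
      · exact (hz2 s (Sym2.mem_mk_left s u')).2 rfl
    · rcases hzL with ⟨-, hz1⟩ | ⟨u', hu', h⟩
      · rcases Set.mem_insert_iff.1 (hz1 s (Sym2.mem_mk_left s u)) with h | h
        · exact hxs h.symm
        · exact hsL h
      · rw [Sym2.eq_iff] at h
        rcases h with ⟨-, rfl⟩ | ⟨-, h2⟩
        · exact hu.1 hu'
        · exact hu.2.1 h2
  set KLf : Finset (Sym2 (Fin n)) := Finset.univ.filter fun z => z ∈ KL with hKLf
  have hKLcoe : (↑KLf : Set (Sym2 (Fin n))) = KL := by ext z; simp [hKLf]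
  have indep : ∀ {A B : Set (BondConfig (Fin n))}, DeterminedBy A KL → DeterminedBy B KR →
      (prodBernoulli w).real (A ∩ B) = (prodBernoulli w).real A * (prodBernoulli w).real B := by
    intro A B hA hB
    have hA' : DeterminedBy A (↑KLf : Set (Sym2 (Fin n))) := by rw [hKLcoe]; exact hA
    have hB' : DeterminedBy B (↑KLf : Set (Sym2 (Fin n)))ᶜ := by rw [hKLcoe]; exact hB.mono hKLR
    exact prodBernoulli_real_inter_of_determinedBy w KLf hA' hB' (hm _) (hm _)
  exact indep hA hB

end IncStar

end Summit.CriticalPhenomena.PercolationContinuityZ3.Theorems
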